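import Mathlib
import Summits.ValiantsHypothesis.ValiantsHypothesis.Theorems.PolyaContinuedLaplaceRigiditySingMultigrading
import Summits.ValiantsHypothesis.ValiantsHypothesis.Theorems.PolyaContinuedLaplaceRigiditySingTopZeroLine
import Summits.ValiantsHypothesis.ValiantsHypothesis.Theorems.PolyaContinuedLaplaceRigiditySingTopLines
import Summits.ValiantsHypothesis.ValiantsHypothesis.Theorems.PolyaContinuedLaplaceRigiditySingKCoreStubs
import Summits.ValiantsHypothesis.ValiantsHypothesis.Theorems.PolyaContinuedLaplaceRigidityTwoLineCase
import HarnessLib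

/-!
# Top-prime rigidity of `Sing(per₄)` (stub B of line `component_rigidity`), def-free

Helper file for the SUPPORT item `PolyaContinued.StrengthTwoPerFourGeFive` (stmt-ValiantsHypothesis-27571, rank 9;
the rung `str₂(per₄) ≥ 5`) under crux `CoverDecancellation` (stmt-ValiantsHypothesis-17819, HELD), route
`PolyaContinued`.  Source prepared by the line owner val-idea-10 g3 from the sorry-free crux workfile
`Cruxes/CoverDecancellation/Lines/component_rigidity.lean` (v8.1 @a26d6b87249c, l.214–666), in the spelling fixed
by director-valiant R228 (a) (path, namespace `TopPrime`, decl names); writer of record per R228 (a): 17819-w1 g3.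
NO definitions: the line's `cellIdeal S` is `Ideal.span ((fun e => X e) '' S)`, its `rowCol i c` / `twoRows` /
`twoCols` / `rowCells` are `Finset.univ.filter` sets (as in `…SingTopLines`, p624852, and `…TwoLineCase`,
p628909), the K-core weight `w(x_{ρc}) = 2^ρ + 16·2^c` is written inline, the transpose is the ring automorphism
`(renameEquiv ℂ (Equiv.prodComm _ _)).toRingEquiv`.

* `exists_pair_of_weight_one_eq_two`, `pow_pair_decode`, `pow_pair_bounds`, `kWeight_decode`,
  `weight_kWeight_pair`, `monomial_pair_eq` — degree-two exponent vectors; the weight `2^ρ + 16·2^c` of a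
  quadratic monomial `x_a x_b` determines its row pair and its column pair (binary decoding, `decide`).
* ★ `kcore_grading` — **LEMMA B, grading half**: if `P` (prime, height `≤ 8`, over `singPermIdeal ℂ 4`) has no
  variable outside row `i` and no K-binomial `x_{ρc}x_{ρ'c'} − γ·x_{ρc'}x_{ρ'c}` (`γ ≠ 0`), every homogeneous
  quadric of `P` lies in `(x_e : e ∈ row i)`.  Torus-stability BY NAME
  (`SingGrading.weightedHomogeneousComponent_mem_of_singPermIdeal_four_le_complex`, p625923) with the
  row/column-additive weight `2^ρ + 16·2^c`; the weight class of a quadric monomial avoiding row `i` is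
  `{x_a x_b, x_{(a₁,b₂)} x_{(b₁,a₂)}}` (`kWeight_decode`); primality + the two hypotheses kill the component.
* ★ `rowPrimeRigidity` — stub B-row: type (L) `SingCodim.eq_span_X_twoRows`, type (X)
  `SingCodim.quadric_mem_span_rowCol` (p624852), K-core `SingCodim.kcore_noVar` / `kcore_noBinomial` (T7/T8,
  p627865) + `kcore_grading`.
* `rename_swap_X`, `rename_swap_rename_swap`, `rename_swap_pderiv`, `singPermIdeal_le_comap_transpose`,
  `map_transpose_span_X`, `image_swap_rowCol`, `image_swap_twoRows` — transport by the transpose (it fixes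
  `per₄`: `TwoLine.rename_swap_perPoly`, p628909).
* ★ `colPrimeRigidity` — stub B-col, from B-row by transposition (`RingEquiv.height_comap`,
  `Ideal.map_comap_of_surjective`).
* ★★ `topPrimeRigidity` — **TOP-PRIME RIGIDITY of `Sing(per₄)`**, stated as p628909's `hB` binder VERBATIM
  (`…TwoLineCase.lean` l.338–348): every prime `P ⊇ singPermIdeal ℂ 4` of height `≤ 8` EITHER has all its
  homogeneous quadrics in `(x_{row i ∪ col c})` for some `i, c` (Kirkup's types (X), (K)), OR is the variable
  ideal of two rows or of two columns (type (L)).  Zero line `SingCodim.row_or_col_subset_of_singPermIdeal_four_le`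
  (p623618) + `rowPrimeRigidity` + `colPrimeRigidity`.  Consumer: port-2 g1's E
  `Theorems/PolyaContinuedStrengthTwoPerFourGeFive.lean` (`TwoLine.twoLineCase_of_topPrimeRigidity topPrimeRigidity`,
  Kumar ideal, Krull, `TwoLine.perPoly_ne_sum_mul_of_mem_span_rowCol`) closing stmt-27571.

HONEST FRAMING: helper layer toward a SUPPORT rung (`str₂(per₄) ≥ 5`, decided, VH-short, never
distance-to-summit); `= 6` (item 25160) GATED and untouched; crux 17819 `CoverDecancellation` HELD and untouched;
nothing here bears on `VP ≠ VNP`, which is NOT proved.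
[cite: Kirkup2008, Thm 14, Prop 11; AlperBogartVelasco2017, §1; folklore graded commutative algebra]
-/

set_option autoImplicit false

-- the mandated summit-side namespace repeats a component by design (single-problem summit)
set_option linter.dupNamespace false

noncomputable section

open MvPolynomial

namespace Summit.ValiantsHypothesis.ValiantsHypothesis.Theorems.PolyaContinuedLaplaceRigidity

namespace TopPrime

open Literature.Computability.AlgebraicComplexity
open Finsupp

/-! ## Degree-two exponent vectors and the K-core weight `2^ρ + 16·2^c` -/

/-- A degree-`2` exponent vector is a sum of two unit vectors. [folklore] -/
theorem exists_pair_of_weight_one_eq_two {σ : Type*} (d : σ →₀ ℕ)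
    (h : weight (1 : σ → ℕ) d = 2) : ∃ a b : σ, d = single a 1 + single b 1 := by
  classical
  have hcard : Multiset.card (toMultiset d) = 2 := by
    rw [card_toMultiset]
    simpa [weight_apply, Finsupp.sum] using h
  obtain ⟨x, y, hxy⟩ := Multiset.card_eq_two.1 hcard
  refine ⟨x, y, ?_⟩
  have := congrArg Multiset.toFinsupp hxy
  rw [Finsupp.toMultiset_toFinsupp] at this
  rw [this, Multiset.insert_eq_cons, ← Multiset.singleton_add, Multiset.toFinsupp_add,
    Multiset.toFinsupp_singleton, Multiset.toFinsupp_singleton]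

/-- binary decoding of a sum of two powers of two below `16` -/
theorem pow_pair_decode : ∀ x y x' y' : Fin 4,
    2 ^ (x' : ℕ) + 2 ^ (y' : ℕ) = 2 ^ (x : ℕ) + 2 ^ (y : ℕ) →
      (x' = x ∧ y' = y) ∨ (x' = y ∧ y' = x) := by
  decide

theorem pow_pair_bounds : ∀ x y : Fin 4,
    2 ≤ 2 ^ (x : ℕ) + 2 ^ (y : ℕ) ∧ 2 ^ (x : ℕ) + 2 ^ (y : ℕ) ≤ 16 := by
  decide

/-- The K-core weight `w(ρ, c) = 2^ρ + 16·2^c` of a quadratic monomial `x_a x_b` determines the unordered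
row pair and the unordered column pair. -/
theorem kWeight_decode (a b a' b' : Fin 4 × Fin 4)
    (h : (2 ^ (a'.1 : ℕ) + 16 * 2 ^ (a'.2 : ℕ)) + (2 ^ (b'.1 : ℕ) + 16 * 2 ^ (b'.2 : ℕ)) =
      (2 ^ (a.1 : ℕ) + 16 * 2 ^ (a.2 : ℕ)) + (2 ^ (b.1 : ℕ) + 16 * 2 ^ (b.2 : ℕ))) :
    ((a'.1 = a.1 ∧ b'.1 = b.1) ∨ (a'.1 = b.1 ∧ b'.1 = a.1)) ∧
    ((a'.2 = a.2 ∧ b'.2 = b.2) ∨ (a'.2 = b.2 ∧ b'.2 = a.2)) := by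
  have hb1 := pow_pair_bounds a.1 b.1
  have hb2 := pow_pair_bounds a'.1 b'.1
  have hb3 := pow_pair_bounds a.2 b.2
  have hb4 := pow_pair_bounds a'.2 b'.2
  have hrows : 2 ^ (a'.1 : ℕ) + 2 ^ (b'.1 : ℕ) = 2 ^ (a.1 : ℕ) + 2 ^ (b.1 : ℕ) := by omega
  have hcols : 2 ^ (a'.2 : ℕ) + 2 ^ (b'.2 : ℕ) = 2 ^ (a.2 : ℕ) + 2 ^ (b.2 : ℕ) := by omega
  exact ⟨pow_pair_decode _ _ _ _ hrows, pow_pair_decode _ _ _ _ hcols⟩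

theorem weight_kWeight_pair (a b : Fin 4 × Fin 4) :
    weight (fun e : Fin 4 × Fin 4 => 2 ^ (e.1 : ℕ) + 16 * 2 ^ (e.2 : ℕ)) (single a 1 + single b 1) =
      (2 ^ (a.1 : ℕ) + 16 * 2 ^ (a.2 : ℕ)) + (2 ^ (b.1 : ℕ) + 16 * 2 ^ (b.2 : ℕ)) := by
  simp [weight_single]

theorem monomial_pair_eq (u v : Fin 4 × Fin 4) (c : ℂ) :
    (monomial (single u 1 + single v 1) c : MvPolynomial (Fin 4 × Fin 4) ℂ) = C c * (X u * X v) := by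
  rw [monomial_single_add, pow_one, ← C_mul_X_eq_monomial]; ring

/-! ## LEMMA B, grading half -/

/-- **LEMMA B, grading half.**  If `P` (prime, height `≤ 8`, over `singPermIdeal ℂ 4`) contains no variable
outside row `i` and no K-binomial, then every homogeneous quadric of `P` lies in `(x_e : e ∈ row i)`.
Proof: `P` is torus-stable for the row/column-additive ℕ-weight `2^ρ + 16·2^c`
(`SingGrading.weightedHomogeneousComponent_mem_of_singPermIdeal_four_le_complex`); the weight component of a
quadric `f ∈ P` through a monomial `x_a x_b` avoiding row `i` is supported on the (row-pair, column-pair)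
class of `x_a x_b` (`kWeight_decode`), i.e. it is `α·x_a x_b + β·x_{(a₁,b₂)} x_{(b₁,a₂)}`; primality +
`hnoVar` + `hnoBin` kill it, so no such monomial occurs and `f ∈ (x_{row i})` by `mem_ideal_span_X_image`.
[cite: Kirkup2008, Prop 11] -/
theorem kcore_grading (P : Ideal (MvPolynomial (Fin 4 × Fin 4) ℂ)) [hP : P.IsPrime]
    (hle : VonZurGathen.singPermIdeal ℂ 4 ≤ P) (h8 : P.height ≤ 8) (i : Fin 4)
    (hnoVar : ∀ e : Fin 4 × Fin 4, e.1 ≠ i → (X e : MvPolynomial (Fin 4 × Fin 4) ℂ) ∉ P)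
    (hnoBin : ∀ ρ ρ' c c' : Fin 4, ρ ≠ i → ρ' ≠ i → ρ ≠ ρ' → c ≠ c' → ∀ γ : ℂ, γ ≠ 0 →
      (X (ρ, c) * X (ρ', c') - C γ * (X (ρ, c') * X (ρ', c)) : MvPolynomial (Fin 4 × Fin 4) ℂ) ∉ P) :
    ∀ f ∈ P, f.IsHomogeneous 2 →
      f ∈ Ideal.span ((fun e => (X e : MvPolynomial (Fin 4 × Fin 4) ℂ)) ''
        ((Finset.univ.filter fun e : Fin 4 × Fin 4 => e.1 = i) : Set (Fin 4 × Fin 4))) := by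
  classical
  intro f hf hhom
  rw [mem_ideal_span_X_image]
  intro d hd
  by_contra hcon
  push Not at hcon
  have hcompP : ∀ m : ℕ,
      weightedHomogeneousComponent (fun e : Fin 4 × Fin 4 => 2 ^ (e.1 : ℕ) + 16 * 2 ^ (e.2 : ℕ)) m f ∈ P :=
    fun m => SingGrading.weightedHomogeneousComponent_mem_of_singPermIdeal_four_le_complex
      (fun r : Fin 4 => 2 ^ (r : ℕ)) (fun c : Fin 4 => 16 * 2 ^ (c : ℕ)) P hle h8 hf m
  have hd2 : weight (1 : Fin 4 × Fin 4 → ℕ) d = 2 := hhom (MvPolynomial.mem_support_iff.1 hd)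
  obtain ⟨a, b, rfl⟩ := exists_pair_of_weight_one_eq_two d hd2
  have hrow_of : ∀ e : Fin 4 × Fin 4,
      (single a 1 + single b 1 : (Fin 4 × Fin 4) →₀ ℕ) e ≠ 0 → e.1 ≠ i := by
    intro e he hei
    exact he (hcon e (by simp [hei]))
  have ha : a.1 ≠ i := hrow_of a (by rw [Finsupp.add_apply, single_eq_same]; omega)
  have hb : b.1 ≠ i := hrow_of b (by rw [Finsupp.add_apply, single_eq_same]; omega)
  -- the weight component of `f` through the monomial `x_a x_b`
  set m := (2 ^ (a.1 : ℕ) + 16 * 2 ^ (a.2 : ℕ)) + (2 ^ (b.1 : ℕ) + 16 * 2 ^ (b.2 : ℕ)) with hm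
  set g := weightedHomogeneousComponent
    (fun e : Fin 4 × Fin 4 => 2 ^ (e.1 : ℕ) + 16 * 2 ^ (e.2 : ℕ)) m f with hg
  have hgP : g ∈ P := hcompP m
  have hcg : ∀ d', coeff d' g =
      if weight (fun e : Fin 4 × Fin 4 => 2 ^ (e.1 : ℕ) + 16 * 2 ^ (e.2 : ℕ)) d' = m
      then coeff d' f else 0 := fun d' => by
    rw [hg, coeff_weightedHomogeneousComponent]
  -- its support: the (row-pair, column-pair) class of `x_a x_b`
  set dt : (Fin 4 × Fin 4) →₀ ℕ := single (a.1, b.2) 1 + single (b.1, a.2) 1 with hdt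
  have hsupp : ∀ d' : (Fin 4 × Fin 4) →₀ ℕ, coeff d' g ≠ 0 →
      d' = single a 1 + single b 1 ∨ d' = dt := by
    intro d' hd'
    rw [hcg] at hd'
    split_ifs at hd' with hw
    · obtain ⟨a', b', rfl⟩ := exists_pair_of_weight_one_eq_two d' (hhom hd')
      rw [weight_kWeight_pair] at hw
      obtain ⟨hr, hc⟩ := kWeight_decode a b a' b' hw
      rcases hr with ⟨h1, h2⟩ | ⟨h1, h2⟩ <;> rcases hc with ⟨h3, h4⟩ | ⟨h3, h4⟩
      · left
        rw [show a' = a from Prod.ext h1 h3, show b' = b from Prod.ext h2 h4]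
      · right
        rw [show a' = (a.1, b.2) from Prod.ext h1 h3, show b' = (b.1, a.2) from Prod.ext h2 h4]
      · right
        rw [show a' = (b.1, a.2) from Prod.ext h1 h3, show b' = (a.1, b.2) from Prod.ext h2 h4,
          add_comm]
      · left
        rw [show a' = b from Prod.ext h1 h3, show b' = a from Prod.ext h2 h4, add_comm]
    · exact absurd rfl hd'
  -- a nonzero scalar multiple of `x_a x_b` in `P` is impossible
  have hmono : ∀ c : ℂ, c ≠ 0 →
      (monomial (single a 1 + single b 1) c : MvPolynomial (Fin 4 × Fin 4) ℂ) ∈ P → False := by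
    intro c hc hmem
    rw [monomial_pair_eq] at hmem
    have h1 : (X a * X b : MvPolynomial (Fin 4 × Fin 4) ℂ) ∈ P := by
      rcases hP.mem_or_mem hmem with h | h
      · exact absurd (P.eq_top_of_isUnit_mem h ((IsUnit.mk0 c hc).map C)) hP.ne_top
      · exact h
    rcases hP.mem_or_mem h1 with h | h
    · exact hnoVar a ha h
    · exact hnoVar b hb h
  have hα : coeff (single a 1 + single b 1) f ≠ 0 := MvPolynomial.mem_support_iff.1 hd
  have hcd : coeff (single a 1 + single b 1) g = coeff (single a 1 + single b 1) f := by
    rw [hcg, if_pos (by rw [weight_kWeight_pair])]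
  by_cases hdeg : a.1 = b.1 ∨ a.2 = b.2
  · -- one monomial in the class
    have hdt_eq : dt = single a 1 + single b 1 := by
      rcases hdeg with h | h
      · have e1 : ((a.1, b.2) : Fin 4 × Fin 4) = b := Prod.ext h rfl
        have e2 : ((b.1, a.2) : Fin 4 × Fin 4) = a := Prod.ext h.symm rfl
        rw [hdt, e1, e2, add_comm]
      · have e1 : ((a.1, b.2) : Fin 4 × Fin 4) = a := Prod.ext rfl h.symm
        have e2 : ((b.1, a.2) : Fin 4 × Fin 4) = b := Prod.ext rfl h
        rw [hdt, e1, e2]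
    have hs : g.support ⊆ {single a 1 + single b 1} := by
      intro v hv
      rcases hsupp v (MvPolynomial.mem_support_iff.1 hv) with h | h
      · simp [h]
      · simp [h, hdt_eq]
    have hg_eq : g = monomial (single a 1 + single b 1) (coeff (single a 1 + single b 1) f) := by
      conv_lhs => rw [g.as_sum, Finset.sum_subset hs (fun v _ hv => by
        rw [MvPolynomial.notMem_support_iff.1 hv, map_zero]), Finset.sum_singleton]
      rw [hcd]
    exact hmono _ hα (hg_eq ▸ hgP)
  · -- a genuine binomial class
    push Not at hdeg
    obtain ⟨h1, h2⟩ := hdeg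
    have hne : single a 1 + single b 1 ≠ dt := by
      intro h
      have := Finsupp.ext_iff.1 h a
      have e1 : a ≠ ((a.1, b.2) : Fin 4 × Fin 4) := fun e => h2 (by
        have := congrArg Prod.snd e; simpa using this)
      have e2 : a ≠ ((b.1, a.2) : Fin 4 × Fin 4) := fun e => h1 (by
        have := congrArg Prod.fst e; simpa using this)
      simp only [hdt, Finsupp.add_apply, single_eq_same, single_eq_of_ne e1, single_eq_of_ne e2]
        at this
      omega
    have hwdt : weight (fun e : Fin 4 × Fin 4 => 2 ^ (e.1 : ℕ) + 16 * 2 ^ (e.2 : ℕ)) dt = m := by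
      rw [hdt, weight_kWeight_pair, hm]
      ring
    set α := coeff (single a 1 + single b 1) f with hαd
    set β := coeff dt f with hβd
    have hcdt : coeff dt g = β := by rw [hcg, if_pos hwdt]
    have hs : g.support ⊆ {single a 1 + single b 1, dt} := by
      intro v hv
      rcases hsupp v (MvPolynomial.mem_support_iff.1 hv) with h | h <;> simp [h]
    have hg_eq : g = monomial (single a 1 + single b 1) α + monomial dt β := by
      conv_lhs => rw [g.as_sum, Finset.sum_subset hs (fun v _ hv => by
        rw [MvPolynomial.notMem_support_iff.1 hv, map_zero]), Finset.sum_pair hne]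
      rw [hcd, hcdt]
    by_cases hβ : β = 0
    · refine hmono α hα ?_
      have : g = monomial (single a 1 + single b 1) α := by rw [hg_eq, hβ, map_zero, add_zero]
      exact this ▸ hgP
    · have key : C α⁻¹ * g =
          X a * X b + C (β / α) * (X (a.1, b.2) * X (b.1, a.2)) := by
        rw [hg_eq, hdt, monomial_pair_eq, monomial_pair_eq, mul_add, div_eq_mul_inv, mul_comm β]
        simp only [← mul_assoc, ← C_mul, inv_mul_cancel₀ hα, C_1, one_mul]
      have hmem : (C α⁻¹ * g : MvPolynomial (Fin 4 × Fin 4) ℂ) ∈ P := P.mul_mem_left _ hgP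
      rw [key] at hmem
      have hmem' : (X (a.1, a.2) * X (b.1, b.2) - C (-(β / α)) * (X (a.1, b.2) * X (b.1, a.2)) :
          MvPolynomial (Fin 4 × Fin 4) ℂ) ∈ P := by
        rw [map_neg, neg_mul, sub_neg_eq_add]
        exact hmem
      exact hnoBin a.1 b.1 a.2 b.2 ha hb h1 h2 (-(β / α)) (by simp [hα, hβ]) hmem'

/-! ## Stub B-row -/

/-- **Stub B-row.**  A height-`≤ 8` prime over `singPermIdeal ℂ 4` that contains all four variables of
row `i` either has all its homogeneous quadrics inside `(x_e : e ∈ row i ∪ col c)` for some column `c`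
(types (X), (K)), or is the ideal of two rows (type (L)).  By name over `SingCodim.eq_span_X_twoRows`,
`SingCodim.quadric_mem_span_rowCol` (p624852), `SingCodim.kcore_noVar` / `kcore_noBinomial` (p627865) and
`kcore_grading`. [cite: Kirkup2008, Thm 14, Prop 11; AlperBogartVelasco2017, §1] -/
theorem rowPrimeRigidity (P : Ideal (MvPolynomial (Fin 4 × Fin 4) ℂ)) [hP : P.IsPrime]
    (hle : VonZurGathen.singPermIdeal ℂ 4 ≤ P) (h8 : P.height ≤ 8) (i : Fin 4)
    (hrow : ∀ j : Fin 4, (X (i, j) : MvPolynomial (Fin 4 × Fin 4) ℂ) ∈ P) :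
    (∃ c : Fin 4, ∀ f ∈ P, f.IsHomogeneous 2 →
        f ∈ Ideal.span ((fun e => (X e : MvPolynomial (Fin 4 × Fin 4) ℂ)) ''
          ((Finset.univ.filter fun e : Fin 4 × Fin 4 => e.1 = i ∨ e.2 = c) : Set (Fin 4 × Fin 4)))) ∨
    (∃ i' : Fin 4, i ≠ i' ∧
        P = Ideal.span ((fun e => (X e : MvPolynomial (Fin 4 × Fin 4) ℂ)) ''
          ((Finset.univ.filter fun e : Fin 4 × Fin 4 => e.1 = i ∨ e.1 = i') : Set (Fin 4 × Fin 4)))) := by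
  classical
  by_cases hrow' : ∃ i' : Fin 4, i' ≠ i ∧ ∀ j : Fin 4, (X (i', j) : MvPolynomial (Fin 4 × Fin 4) ℂ) ∈ P
  · obtain ⟨i', hne, hi'⟩ := hrow'
    exact Or.inr ⟨i', fun h => hne h.symm, SingCodim.eq_span_X_twoRows ℂ (fun h => hne h.symm) P h8 hrow hi'⟩
  by_cases hcol : ∃ c : Fin 4, ∀ r : Fin 4, (X (r, c) : MvPolynomial (Fin 4 × Fin 4) ℂ) ∈ P
  · obtain ⟨c, hc⟩ := hcol
    refine Or.inl ⟨c, fun f hf hhom => ?_⟩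
    have hle' : BoraleviCarliniMichalekVentura2025.subpermIdeal ℂ 4 4 3 ≤ P := by
      have h := BoraleviCarliniMichalekVentura2025.singPermIdeal_eq_subpermIdeal ℂ (m := 4) (by norm_num)
      rw [h] at hle
      exact hle
    exact SingCodim.quadric_mem_span_rowCol ℂ i c P hle' h8 hrow hc f hf hhom
  · push Not at hrow' hcol
    have hnv := SingCodim.kcore_noVar P hle h8 i hrow hrow' hcol
    have hnb := SingCodim.kcore_noBinomial P hle h8 i hrow hrow' hcol
    refine Or.inl ⟨0, fun f hf hhom => ?_⟩
    refine Ideal.span_mono (Set.image_mono (Finset.coe_subset.2 fun e he => ?_))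
      (kcore_grading P hle h8 i hnv hnb f hf hhom)
    simp only [Finset.mem_filter, Finset.mem_univ, true_and] at he ⊢
    exact Or.inl he

/-! ## Transport by the transpose `x_{ij} ↦ x_{ji}` and stub B-col -/

theorem rename_swap_X (e : Fin 4 × Fin 4) :
    rename Prod.swap (X e : MvPolynomial (Fin 4 × Fin 4) ℂ) = X e.swap :=
  rename_X _ _

theorem rename_swap_rename_swap (f : MvPolynomial (Fin 4 × Fin 4) ℂ) :
    rename Prod.swap (rename Prod.swap f) = f := by
  rw [rename_rename, Prod.swap_swap_eq, rename_id]
  rfl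

theorem rename_swap_pderiv (e : Fin 4 × Fin 4) (f : MvPolynomial (Fin 4 × Fin 4) ℂ) :
    rename Prod.swap (pderiv e f) = pderiv e.swap (rename Prod.swap f) := by
  rw [pderiv_rename Prod.swap_injective]

/-- `singPermIdeal ℂ 4` is carried into any ideal containing it by the transpose (which fixes `per₄`:
`TwoLine.rename_swap_perPoly`, p628909). -/
theorem singPermIdeal_le_comap_transpose {P : Ideal (MvPolynomial (Fin 4 × Fin 4) ℂ)}
    (h : VonZurGathen.singPermIdeal ℂ 4 ≤ P) :
    VonZurGathen.singPermIdeal ℂ 4 ≤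
      P.comap (MvPolynomial.renameEquiv ℂ (Equiv.prodComm (Fin 4) (Fin 4))).toRingEquiv := by
  unfold VonZurGathen.singPermIdeal
  rw [Ideal.span_le]
  rintro g hg
  rw [SetLike.mem_coe, Ideal.mem_comap]
  change rename Prod.swap g ∈ P
  rcases hg with rfl | ⟨e, rfl⟩
  · rw [TwoLine.rename_swap_perPoly]; exact h (VonZurGathen.perPoly_mem_singPermIdeal ℂ 4)
  · rw [rename_swap_pderiv, TwoLine.rename_swap_perPoly]
    exact h (Ideal.subset_span (Set.mem_insert_of_mem _ ⟨e.swap, rfl⟩))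

/-- The transpose maps the variable ideal of a cell set to that of the transposed cell set. -/
theorem map_transpose_span_X (S : Finset (Fin 4 × Fin 4)) :
    (Ideal.span ((fun e => (X e : MvPolynomial (Fin 4 × Fin 4) ℂ)) '' (S : Set (Fin 4 × Fin 4)))).map
        (MvPolynomial.renameEquiv ℂ (Equiv.prodComm (Fin 4) (Fin 4))).toRingEquiv =
      Ideal.span ((fun e => (X e : MvPolynomial (Fin 4 × Fin 4) ℂ)) ''
        ((S.image Prod.swap : Finset (Fin 4 × Fin 4)) : Set (Fin 4 × Fin 4))) := by
  rw [Ideal.map_span, ← Set.image_comp, Finset.coe_image, ← Set.image_comp]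
  congr 1
  ext f
  simp only [Set.mem_image, Function.comp_apply]
  constructor
  · rintro ⟨e, he, rfl⟩
    exact ⟨e, he, by change X e.swap = rename Prod.swap (X e); rw [rename_swap_X]⟩
  · rintro ⟨e, he, rfl⟩
    exact ⟨e, he, by change rename Prod.swap (X e) = X e.swap; rw [rename_swap_X]⟩

theorem image_swap_rowCol (i c : Fin 4) :
    (Finset.univ.filter fun e : Fin 4 × Fin 4 => e.1 = i ∨ e.2 = c).image Prod.swap =
      Finset.univ.filter fun e : Fin 4 × Fin 4 => e.1 = c ∨ e.2 = i := by
  ext e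
  simp only [Finset.mem_image, Finset.mem_filter, Finset.mem_univ, true_and]
  constructor
  · rintro ⟨e', h, rfl⟩; simpa [or_comm] using h
  · intro h; exact ⟨e.swap, by simpa [or_comm] using h, Prod.swap_swap e⟩

theorem image_swap_twoRows (i i' : Fin 4) :
    (Finset.univ.filter fun e : Fin 4 × Fin 4 => e.1 = i ∨ e.1 = i').image Prod.swap =
      Finset.univ.filter fun e : Fin 4 × Fin 4 => e.2 = i ∨ e.2 = i' := by
  ext e
  simp only [Finset.mem_image, Finset.mem_filter, Finset.mem_univ, true_and]
  constructor
  · rintro ⟨e', h, rfl⟩; simpa using h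
  · intro h; exact ⟨e.swap, by simpa using h, Prod.swap_swap e⟩

/-- **Stub B-col** (from B-row by transposition).  A height-`≤ 8` prime over `singPermIdeal ℂ 4` containing
all four variables of column `c` either has all its homogeneous quadrics inside `(x_e : e ∈ row i ∪ col c)`
for some row `i`, or is the ideal of two columns. [cite: Kirkup2008, Thm 14] -/
theorem colPrimeRigidity (P : Ideal (MvPolynomial (Fin 4 × Fin 4) ℂ)) [hP : P.IsPrime]
    (hle : VonZurGathen.singPermIdeal ℂ 4 ≤ P) (h8 : P.height ≤ 8) (c : Fin 4)
    (hcol : ∀ r : Fin 4, (X (r, c) : MvPolynomial (Fin 4 × Fin 4) ℂ) ∈ P) :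
    (∃ i : Fin 4, ∀ f ∈ P, f.IsHomogeneous 2 →
        f ∈ Ideal.span ((fun e => (X e : MvPolynomial (Fin 4 × Fin 4) ℂ)) ''
          ((Finset.univ.filter fun e : Fin 4 × Fin 4 => e.1 = i ∨ e.2 = c) : Set (Fin 4 × Fin 4)))) ∨
    (∃ c' : Fin 4, c ≠ c' ∧
        P = Ideal.span ((fun e => (X e : MvPolynomial (Fin 4 × Fin 4) ℂ)) ''
          ((Finset.univ.filter fun e : Fin 4 × Fin 4 => e.2 = c ∨ e.2 = c') : Set (Fin 4 × Fin 4)))) := by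
  -- the transposed prime `Q = tr⁻¹ P`
  set T : MvPolynomial (Fin 4 × Fin 4) ℂ ≃+* MvPolynomial (Fin 4 × Fin 4) ℂ :=
    (MvPolynomial.renameEquiv ℂ (Equiv.prodComm (Fin 4) (Fin 4))).toRingEquiv with hT
  have hTapp : ∀ f, T f = rename Prod.swap f := fun f => rfl
  haveI hQP : (P.comap T).IsPrime := Ideal.comap_isPrime T P
  have hQle : VonZurGathen.singPermIdeal ℂ 4 ≤ P.comap T := singPermIdeal_le_comap_transpose hle
  have hQ8 : (P.comap T).height ≤ 8 := by rw [RingEquiv.height_comap]; exact h8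
  have hrow : ∀ j : Fin 4, (X (c, j) : MvPolynomial (Fin 4 × Fin 4) ℂ) ∈ P.comap T := by
    intro j; rw [Ideal.mem_comap, hTapp, rename_swap_X]; exact hcol j
  rcases rowPrimeRigidity (P.comap T) hQle hQ8 c hrow with ⟨c', h⟩ | ⟨i', hci', h⟩
  · refine Or.inl ⟨c', fun f hf hf2 => ?_⟩
    have htf : T f ∈ P.comap T := by rw [Ideal.mem_comap, hTapp, hTapp, rename_swap_rename_swap]; exact hf
    have htf2 : (T f).IsHomogeneous 2 := by rw [hTapp]; exact hf2.rename_isHomogeneous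
    have hmem := Ideal.mem_map_of_mem T (h (T f) htf htf2)
    rw [map_transpose_span_X, image_swap_rowCol] at hmem
    have hTT : T (T f) = f := by rw [hTapp, hTapp, rename_swap_rename_swap]
    rwa [hTT] at hmem
  · refine Or.inr ⟨i', hci', ?_⟩
    have := congrArg (Ideal.map T) h
    rwa [Ideal.map_comap_of_surjective _ T.surjective, map_transpose_span_X, image_swap_twoRows] at this

/-! ## Stub B: top-prime rigidity -/

/-- **TOP-PRIME RIGIDITY of `Sing(per₄)`** (stub B of line `component_rigidity`, in the unfolded form consumed
by `TwoLine.commonZero_twoLines`).  Every prime `P` of height `≤ 8` containing `singPermIdeal ℂ 4` — i.e.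
the ideal of a top-dimensional component of `Sing(per₄) = {all 3×3 sub-permanents vanish}` — EITHER has all
its homogeneous quadrics in the variable ideal of some row `i` ∪ column `c` (Kirkup's types (X) and (K)), OR
is the ideal of the variables of two rows or of two columns (type (L)).  By name: the zero line
`SingCodim.row_or_col_subset_of_singPermIdeal_four_le` (p623618), `rowPrimeRigidity`, `colPrimeRigidity`.
[cite: Kirkup2008, Thm 14, Prop 11; AlperBogartVelasco2017, §1] -/
theorem topPrimeRigidity :
    ∀ P : Ideal (MvPolynomial (Fin 4 × Fin 4) ℂ), P.IsPrime →
      VonZurGathen.singPermIdeal ℂ 4 ≤ P → P.height ≤ 8 →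
        (∃ i c : Fin 4, ∀ f ∈ P, f.IsHomogeneous 2 →
            f ∈ Ideal.span ((fun e => (X e : MvPolynomial (Fin 4 × Fin 4) ℂ)) ''
              ((Finset.univ.filter fun e : Fin 4 × Fin 4 => e.1 = i ∨ e.2 = c) : Set _))) ∨
        (∃ i i' : Fin 4, i ≠ i' ∧
          (P = Ideal.span ((fun e => (X e : MvPolynomial (Fin 4 × Fin 4) ℂ)) ''
              ((Finset.univ.filter fun e : Fin 4 × Fin 4 => e.1 = i ∨ e.1 = i') : Set _)) ∨
           P = Ideal.span ((fun e => (X e : MvPolynomial (Fin 4 × Fin 4) ℂ)) ''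
              ((Finset.univ.filter fun e : Fin 4 × Fin 4 => e.2 = i ∨ e.2 = i') : Set _)))) := by
  intro P hP hle h8
  rcases SingCodim.row_or_col_subset_of_singPermIdeal_four_le ℂ (by norm_num) (by norm_num) P hle h8 with
    ⟨i, hi⟩ | ⟨c, hcol⟩
  · rcases rowPrimeRigidity P hle h8 i hi with ⟨c, h⟩ | ⟨i', hii', h⟩
    · exact Or.inl ⟨i, c, h⟩
    · exact Or.inr ⟨i, i', hii', Or.inl h⟩
  · rcases colPrimeRigidity P hle h8 c hcol with ⟨i, h⟩ | ⟨c', hcc', h⟩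
    · exact Or.inl ⟨i, c, h⟩
    · exact Or.inr ⟨c, c', hcc', Or.inr h⟩

end TopPrime

end Summit.ValiantsHypothesis.ValiantsHypothesis.Theorems.PolyaContinuedLaplaceRigidity

end
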